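import Literature.Probability.RandomPlanarGeometry.SAWPulledLargeForceExpansionZdSixStep
import HarnessLib

/-!
# The pulled self-avoiding walk on `ℤ^{d+1}` at large force: THE FIFTH COEFFICIENT `c^{(d)}_5 = 2d(8d³ + 28d² + 2d − 1)` —
# the cost-five irreducible bridges of length seven (four hook profiles) and the fifth-order expansion in every dimension

Topic `Literature/Probability/RandomPlanarGeometry` (continues `SAWPulledLargeForceExpansionZdSixStep.lean` (`a_five`, `e_five_eq`,
`N_{5,6}`), `…ZdFourthOrder.lean` (hooks of length six, the cost-four census, `costCoeffZd_eq_zero_of_three_span`),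
`…ZdHeights.lean` (height-profile tools) and `…ZdThirdOrder.lean` (`fourStepIndex`, `card_fourStepIndex = 2d(2d−1)²`)).

Printed sources: E. J. Janse van Rensburg, S. G. Whittington, J. Phys. A 46 (2013) 435003, §3.2 Theorem 8 (first order only);
N. Madras, G. Slade, *The Self-Avoiding Walk* (1993), §4.2. The fifth coefficient in general dimension is not in print (lane «pcv-sawmu»).

## Contents (all PROVED, standard axioms only; no data, no certificates)

* the four length-seven hook profiles, TABLE-DRIVEN: height tables `hook7H κ` = `0,1,2,2,1,1,2,2` / `0,1,2,2,1,1,1,2` / `0,1,2,2,2,1,1,2` /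
  `0,1,1,2,2,1,1,2` and transverse-count tables `hook7T κ` (`κ : Fin 4`); the table facts (`decide`); the walks
  `hook7 d κ (v,w,x) i = hook7H κ i · e₀ + (first hook7T κ i of v, w, x)` over `fourStepIndex` (`w ≠ −v`, `x ≠ −w`); generic
  `hook7_mem_saws` / `hook7_mem_filter` from the tables; ★ `eq_hook7_of_mem` (the height profile `0,1,h₂,…,h₆,2` of a cost-five
  irreducible bridge of length seven is one of the four — nineteen-leaf case analysis with `not_irreducible_of_monotone`,
  `no_up_down_of_mem_saws`, `no_down_up_of_mem_saws`); `hook7_injective`, images pairwise disjoint; ★ `costCoeffZd_five_seven`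
  (`N_{5,7} = 4 · 2d(2d−1)²`); ★ `costCoeffZd_five`.
* moments `pQ_one = 0`, `pT_two`, `pH_three`, `pD_four`, ★ `pS_five = 32d⁵ − 64d⁴ + 64d³ − 20d² − 2d`; `aZd_five = −(32d⁵ + 160d⁴ + 168d³ + 12d² − 2d)`;
  ★★ **`largeForceCoeffZd_at_five : largeForceCoeffZd d 5 = 2d(8d³ + 28d² + 2d − 1)`**; `ℤ²`: `largeForceCoeff_five_eq : largeForceCoeff 5 = 74`
  (the certified fifth coefficient of `SAWPulledLargeForceFifthOrderLower`, certificate-free); ★★ `exp_pulledBridgeFreeEnergy_fifth_order_zd`.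

Provenance: lane «pcv-sawmu», a-p3 g16 (2026-08-24); `2d(8d³+28d²+2d−1)` was first observed numerically (kit j223029, a-p3 g15).
-/

noncomputable section

open Finset Filter Topology
open scoped BigOperators
open Literature.Probability.LatticeModels
open Literature.Probability.RandomPlanarGeometry.SAW

namespace Literature.Probability.RandomPlanarGeometry.SAW.Zd

/-! ### The tables of the four length-seven hook profiles -/

/-- Height tables (`κ = 0,1,2,3`): `0,1,2,2,1,1,2,2` · `0,1,2,2,1,1,1,2` · `0,1,2,2,2,1,1,2` · `0,1,1,2,2,1,1,2` (frozen from index `7`).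
[cite: MadrasSlade1993, Definition 1.2.4] -/
def hook7H (κ : Fin 4) (i : ℕ) : ℕ :=
  (([[0, 1, 2, 2, 1, 1, 2, 2], [0, 1, 2, 2, 1, 1, 1, 2], [0, 1, 2, 2, 2, 1, 1, 2], [0, 1, 1, 2, 2, 1, 1, 2]] : List (List ℕ)).getD κ []).getD
    (if i ≤ 7 then i else 7) 2

/-- Transverse-count tables: `0,0,0,1,1,2,2,3` · `0,0,0,1,1,2,3,3` · `0,0,0,1,2,2,3,3` · `0,0,1,1,2,2,3,3` (frozen from index `7`).
[cite: MadrasSlade1993, Definition 1.2.4] -/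
def hook7T (κ : Fin 4) (i : ℕ) : ℕ :=
  (([[0, 0, 0, 1, 1, 2, 2, 3], [0, 0, 0, 1, 1, 2, 3, 3], [0, 0, 0, 1, 2, 2, 3, 3], [0, 0, 1, 1, 2, 2, 3, 3]] : List (List ℕ)).getD κ []).getD
    (if i ≤ 7 then i else 7) 3

/-- The tables are frozen from index `7`. [cite: MadrasSlade1993, Definition 1.2.4] -/
theorem hook7H_of_seven_le (κ : Fin 4) {i : ℕ} (hi : 7 ≤ i) : hook7H κ i = hook7H κ 7 := by
  unfold hook7H
  by_cases h : i ≤ 7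
  · rw [le_antisymm h hi]
  · rw [if_neg h, if_pos le_rfl]

/-- The tables are frozen from index `7`. [cite: MadrasSlade1993, Definition 1.2.4] -/
theorem hook7T_of_seven_le (κ : Fin 4) {i : ℕ} (hi : 7 ≤ i) : hook7T κ i = hook7T κ 7 := by
  unfold hook7T
  by_cases h : i ≤ 7
  · rw [le_antisymm h hi]
  · rw [if_neg h, if_pos le_rfl]

/-- Table fact: `H 0 = 0`, `T 0 = T 1 = 0`, `H 7 = 2`, `T 7 = 3`. [cite: MadrasSlade1993, Definition 1.2.4] -/
theorem hook7_table_ends : ∀ κ : Fin 4, hook7H κ 0 = 0 ∧ hook7T κ 0 = 0 ∧ hook7T κ 1 = 0 ∧ hook7H κ 1 = 1 ∧ hook7H κ 7 = 2 ∧ hook7T κ 7 = 3 := by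
  decide

/-- Table fact (bridge): `1 ≤ H i ≤ 2` for `1 ≤ i ≤ 7`. [cite: MadrasSlade1993, Definition 1.2.4] -/
theorem hook7_table_bridge : ∀ κ : Fin 4, ∀ i, i ≤ 7 → 1 ≤ i → 1 ≤ hook7H κ i ∧ hook7H κ i ≤ 2 := by
  decide

/-- Table fact: `T i ≤ 3`. [cite: MadrasSlade1993, Definition 1.2.4] -/
theorem hook7_table_T_le : ∀ κ : Fin 4, ∀ i, i ≤ 7 → hook7T κ i ≤ 3 := by
  decide

/-- Table fact (steps): each step is up, down or transverse. [cite: MadrasSlade1993, Definition 1.2.4] -/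
theorem hook7_table_step : ∀ κ : Fin 4, ∀ i, i ≤ 6 →
    (hook7H κ (i + 1) = hook7H κ i + 1 ∧ hook7T κ (i + 1) = hook7T κ i) ∨
    (hook7H κ (i + 1) + 1 = hook7H κ i ∧ hook7T κ (i + 1) = hook7T κ i) ∨
    (hook7H κ (i + 1) = hook7H κ i ∧ hook7T κ (i + 1) = hook7T κ i + 1 ∧ hook7T κ i ≤ 2) := by
  decide

/-- Table fact (injectivity of `i ↦ (H i, T i)`). [cite: MadrasSlade1993, Definition 1.2.4] -/
theorem hook7_table_inj : ∀ κ : Fin 4, ∀ i, i ≤ 7 → ∀ j, j ≤ 7 → hook7H κ i = hook7H κ j → hook7T κ i = hook7T κ j → i = j := by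
  decide

/-- Table fact (no renewal time in `[1,6]`). [cite: DuminilCopinHammond2013, §2.2] -/
theorem hook7_table_noRenewal : ∀ κ : Fin 4, ∀ k, 1 ≤ k → k ≤ 6 →
    ¬ ((∀ i, 1 ≤ i → i ≤ k → hook7H κ i ≤ hook7H κ k) ∧ (∀ j, 1 ≤ j → j ≤ 7 - k → hook7H κ k < hook7H κ (k + j))) := by
  decide

/-- Table fact (the four height profiles are pairwise different). [cite: MadrasSlade1993, Definition 1.2.4] -/
theorem hook7_table_sep : ∀ κ κ' : Fin 4, (∀ i, i ≤ 7 → hook7H κ i = hook7H κ' i) → κ = κ' := by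
  decide

/-! ### The partial sums of the three transverse steps and the table-driven walks -/

/-- The partial sums `0, v, v+w, v+w+x` (frozen from `3`). [cite: MadrasSlade1993, Definition 1.2.4] -/
def psum3 (d : ℕ) (s : (Fin d × Bool) × (Fin d × Bool) × (Fin d × Bool)) : ℕ → Site (d + 1)
  | 0 => 0
  | 1 => twoStepV d s.1
  | 2 => twoStepV d s.1 + twoStepV d s.2.1
  | _ + 3 => twoStepV d s.1 + twoStepV d s.2.1 + twoStepV d s.2.2

/-- `psum3` has no `e₀`-component. [cite: MadrasSlade1993, Definition 1.2.4] -/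
@[simp] theorem psum3_apply_zero (d : ℕ) (s) : ∀ t, psum3 d s t 0 = 0
  | 0 => rfl
  | 1 => by simp [psum3]
  | 2 => by simp [psum3]
  | _ + 3 => by simp [psum3]

/-- The next transverse step: `psum3 (t+1) = psum3 t + (v, w, x)_t` for `t ≤ 2`. [cite: MadrasSlade1993, Definition 1.2.4] -/
theorem psum3_succ (d : ℕ) (s) {t : ℕ} (ht : t ≤ 2) : ∃ a : Fin d × Bool, psum3 d s (t + 1) = psum3 d s t + twoStepV d a := by
  interval_cases t
  · exact ⟨s.1, by simp [psum3]⟩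
  · exact ⟨s.2.1, by simp [psum3]⟩
  · exact ⟨s.2.2, by simp [psum3]⟩

/-- `psum3` is injective on `{0,1,2,3}` when `w ≠ −v`, `x ≠ −w`. [cite: MadrasSlade1993, Definition 1.2.4] -/
theorem psum3_inj (d : ℕ) {s} (hs : s ∈ fourStepIndex d) {t t' : ℕ} (ht : t ≤ 3) (ht' : t' ≤ 3)
    (h : psum3 d s t = psum3 d s t') : t = t' := by
  obtain ⟨h12, h23⟩ := (Finset.mem_filter.1 hs).2
  by_contra hne
  wlog hlt : t < t' generalizing t t'
  · exact this ht' ht h.symm (Ne.symm hne) (by omega)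
  have key : (t = 0 ∧ t' = 1) ∨ (t = 0 ∧ t' = 2) ∨ (t = 0 ∧ t' = 3) ∨ (t = 1 ∧ t' = 2) ∨ (t = 1 ∧ t' = 3) ∨ (t = 2 ∧ t' = 3) := by
    omega
  rcases key with ⟨rfl, rfl⟩ | ⟨rfl, rfl⟩ | ⟨rfl, rfl⟩ | ⟨rfl, rfl⟩ | ⟨rfl, rfl⟩ | ⟨rfl, rfl⟩
  · simp only [psum3] at h
    exact twoStepV_ne_zero d s.1 h.symm
  · simp only [psum3] at h
    exact twoStepV_add_ne_zero d h12 h.symm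
  · simp only [psum3] at h
    exact twoStepV_add_add_ne_zero d _ _ _ h.symm
  · simp only [psum3] at h
    exact twoStepV_ne_zero d s.2.1 (by simpa using h.symm)
  · simp only [psum3, add_assoc] at h
    exact twoStepV_add_ne_zero d h23 (by simpa using h.symm)
  · simp only [psum3] at h
    exact twoStepV_ne_zero d s.2.2 (by simpa using h.symm)

/-- The table-driven length-seven hooks: `hook7 κ (v,w,x) i = H_κ(i) e₀ + psum3 (T_κ(i))`. [cite: MadrasSlade1993, Definition 1.2.4] -/
def hook7 (d : ℕ) (κ : Fin 4) (s : (Fin d × Bool) × (Fin d × Bool) × (Fin d × Bool)) (i : ℕ) : Site (d + 1) :=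
  Pi.single 0 (hook7H κ i : ℤ) + psum3 d s (hook7T κ i)

/-- Heights along `hook7 κ`: the table `hook7H κ`. [cite: MadrasSlade1993, Definition 1.2.4] -/
theorem hook7_apply_zero (d : ℕ) (κ : Fin 4) (s) (i : ℕ) : hook7 d κ s i 0 = hook7H κ i := by
  simp [hook7]

/-- `hook7` is frozen from index `7`. [cite: MadrasSlade1993, Definition 1.2.4] -/
theorem hook7_of_seven_le (d : ℕ) (κ : Fin 4) (s) {i : ℕ} (hi : 7 ≤ i) : hook7 d κ s i = hook7 d κ s 7 := by
  rw [hook7, hook7, hook7H_of_seven_le κ hi, hook7T_of_seven_le κ hi]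

/-- Consecutive sites of `hook7 κ` are lattice neighbours. [cite: MadrasSlade1993, Definition 1.2.4] -/
theorem hook7_adj (d : ℕ) (κ : Fin 4) (s) {i : ℕ} (hi : i < 7) : (zdGraph (d + 1)).Adj (hook7 d κ s i) (hook7 d κ s (i + 1)) := by
  rcases hook7_table_step κ i (by omega) with ⟨hH, hT⟩ | ⟨hH, hT⟩ | ⟨hH, hT, hT2⟩
  · -- up
    have : hook7 d κ s (i + 1) = hook7 d κ s i + Pi.single 0 1 := by
      rw [hook7, hook7, hT, hH, Nat.cast_add, Nat.cast_one, Pi.single_add]; abel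
    rw [this]; exact adj_add_e0 d _
  · -- down
    have : hook7 d κ s i = hook7 d κ s (i + 1) + Pi.single 0 1 := by
      rw [hook7, hook7, hT, ← hH, Nat.cast_add, Nat.cast_one, Pi.single_add]; abel
    rw [this]; exact (adj_add_e0 d _).symm
  · -- transverse
    obtain ⟨a, ha⟩ := psum3_succ d s hT2
    have : hook7 d κ s (i + 1) = hook7 d κ s i + twoStepV d a := by
      rw [hook7, hook7, hT, hH, ha]; abel
    rw [this]; exact adj_add_twoStepV d _ _

/-- `hook7 κ s`, `s ∈ fourStepIndex`, is a seven-step self-avoiding walk. [cite: MadrasSlade1993, Definition 1.2.4] -/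
theorem hook7_mem_saws (d : ℕ) (κ : Fin 4) {s} (hs : s ∈ fourStepIndex d) : hook7 d κ s ∈ saws (d + 1) 7 := by
  obtain ⟨hH0, hT0, -, -, -, -⟩ := hook7_table_ends κ
  refine mem_saws.2 ⟨?_, fun i hi => hook7_of_seven_le d κ s hi, fun i hi => hook7_adj d κ s hi, ?_⟩
  · rw [hook7, hH0, hT0]; simp [psum3]
  · intro i hi j hj h
    simp only [Set.mem_setOf_eq] at hi hj
    have hH : hook7H κ i = hook7H κ j := by
      have := congrFun h 0
      rw [hook7_apply_zero, hook7_apply_zero] at this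
      exact_mod_cast this
    have hP : psum3 d s (hook7T κ i) = psum3 d s (hook7T κ j) := by
      have h' : hook7 d κ s i - Pi.single 0 (hook7H κ i : ℤ) = hook7 d κ s j - Pi.single 0 (hook7H κ j : ℤ) := by rw [h, hH]
      simpa [hook7] using h'
    have hT : hook7T κ i = hook7T κ j := psum3_inj d hs (hook7_table_T_le κ i hi) (hook7_table_T_le κ j hj) hP
    exact hook7_table_inj κ i hi j hj hH hT

/-- `hook7 κ s` is a bridge of span two. [cite: MadrasSlade1993, Definition 1.2.4] -/
theorem hook7_isBridge (d : ℕ) (κ : Fin 4) (s) : IsBridge 7 (hook7 d κ s) := by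
  intro i h1 h7
  obtain ⟨hH0, -, -, -, hH7, -⟩ := hook7_table_ends κ
  obtain ⟨h1', h2'⟩ := hook7_table_bridge κ i h7 h1
  rw [hook7_apply_zero, hook7_apply_zero, hook7_apply_zero, hH0, hH7]
  exact ⟨by exact_mod_cast h1', by exact_mod_cast h2'⟩

/-- `hook7 κ s` is an irreducible bridge of cost five. [cite: DuminilCopinHammond2013, §2.2] -/
theorem hook7_mem_filter (d : ℕ) (κ : Fin 4) {s} (hs : s ∈ fourStepIndex d) :
    hook7 d κ s ∈ (irreducibleBridges (d + 1) 7).filter fun ω => costZd d 7 ω = 5 := by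
  obtain ⟨-, -, -, -, hH7, -⟩ := hook7_table_ends κ
  refine Finset.mem_filter.2 ⟨mem_irreducibleBridges.2 ⟨mem_bridges.2 ⟨hook7_mem_saws d κ hs, hook7_isBridge d κ s⟩,
    ⟨by norm_num, hook7_isBridge d κ s, fun k hk1 hk2 hren => ?_⟩⟩, ?_⟩
  · obtain ⟨-, hb1, hb2⟩ := hren
    refine hook7_table_noRenewal κ k hk1 (by omega) ⟨fun i hi1 hi2 => ?_, fun j hj1 hj2 => ?_⟩
    · have := (hb1 i hi1 hi2).2
      rw [hook7_apply_zero, hook7_apply_zero] at this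
      exact_mod_cast this
    · have := (hb2 j hj1 hj2).1
      simp only [add_zero, hook7_apply_zero] at this
      exact_mod_cast this
  · simp [costZd, hook7_apply_zero, hH7]

/-! ### Every cost-five irreducible bridge of length seven is one of the four hooks -/

/-- `2e₀` as a single. [cite: MadrasSlade1993, Definition 1.2.4] -/
theorem e0_add_e0 (d : ℕ) : (Pi.single 0 1 : Site (d + 1)) + Pi.single 0 1 = Pi.single 0 2 := by
  rw [← Pi.single_add]; norm_num

/-- ★ **The height profile `0, 1, h₂, …, h₆, 2` (`hᵢ ∈ {1,2}`) of a cost-five irreducible bridge of length seven is one of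
`0,1,2,2,1,1,2,2` / `0,1,2,2,1,1,1,2` / `0,1,2,2,2,1,1,2` / `0,1,1,2,2,1,1,2`** (monotone profiles are reducible; `1,2,1` and `2,1,2` revisit a site).
[cite: DuminilCopinHammond2013, §2.2] -/
theorem heights_of_mem_seven (d : ℕ) {ω : ℕ → Site (d + 1)}
    (hω : ω ∈ (irreducibleBridges (d + 1) 7).filter fun ω => costZd d 7 ω = 5) :
    ω 1 0 = 1 ∧ ω 7 0 = 2 ∧
    ((ω 2 0 = 2 ∧ ω 3 0 = 2 ∧ ω 4 0 = 1 ∧ ω 5 0 = 1 ∧ ω 6 0 = 2) ∨ (ω 2 0 = 2 ∧ ω 3 0 = 2 ∧ ω 4 0 = 1 ∧ ω 5 0 = 1 ∧ ω 6 0 = 1) ∨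
     (ω 2 0 = 2 ∧ ω 3 0 = 2 ∧ ω 4 0 = 2 ∧ ω 5 0 = 1 ∧ ω 6 0 = 1) ∨ (ω 2 0 = 1 ∧ ω 3 0 = 2 ∧ ω 4 0 = 2 ∧ ω 5 0 = 1 ∧ ω 6 0 = 1)) := by
  obtain ⟨hirr, hcost⟩ := Finset.mem_filter.1 hω
  obtain ⟨hbr, hI⟩ := mem_irreducibleBridges.1 hirr
  obtain ⟨hωs, hb⟩ := mem_bridges.1 hbr
  obtain ⟨h0, -, hadj, hinj⟩ := mem_saws.1 hωs
  have hω1 : ω 1 = Pi.single 0 1 := apply_one_eq_e0_of_mem_bridges d (by norm_num) hbr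
  have h00 : ω 0 0 = 0 := by rw [h0]; rfl
  have h1 : ω 1 0 = 1 := by rw [hω1]; simp
  have h7 : ω 7 0 = 2 := by
    simp only [costZd] at hcost
    have := (span_le_and_cost_bound_zd hirr).1
    have h70 : 0 < ω 7 0 := by have := (hb 7 (by norm_num) le_rfl).1; rwa [h0] at this
    omega
  have hb2 := hb 2 (by norm_num) (by norm_num)
  have hb3 := hb 3 (by norm_num) (by norm_num)
  have hb4 := hb 4 (by norm_num) (by norm_num)
  have hb5 := hb 5 (by norm_num) (by norm_num)
  have hb6 := hb 6 (by norm_num) (by norm_num)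
  rw [h0, h7] at hb2 hb3 hb4 hb5 hb6
  simp only [Pi.zero_apply] at hb2 hb3 hb4 hb5 hb6
  have ud : ∀ i, i + 2 ≤ 7 → ω (i + 1) 0 = ω i 0 + 1 → ω (i + 2) 0 = ω (i + 1) 0 - 1 → False :=
    fun i hi e1 e2 => no_up_down_of_mem_saws d hωs hi e1 e2
  have du : ∀ i, i + 2 ≤ 7 → ω (i + 1) 0 = ω i 0 - 1 → ω (i + 2) 0 = ω (i + 1) 0 + 1 → False :=
    fun i hi e1 e2 => no_down_up_of_mem_saws d hωs hi e1 e2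
  have mono : (∀ i < 7, ω i 0 ≤ ω (i + 1) 0) → False := fun hm => not_irreducible_of_monotone d hirr hm (by rw [h7])
  refine ⟨h1, h7, ?_⟩
  rcases (show ω 6 0 = 1 ∨ ω 6 0 = 2 by omega) with h6 | h6
  · -- `h₆ = 1`: then `h₅ = 1` (else `2,1,2` at `5,6,7`)
    have h5 : ω 5 0 = 1 := by
      rcases (show ω 5 0 = 1 ∨ ω 5 0 = 2 by omega) with h | h5
      · exact h
      · exact (du 5 (by norm_num) (by simp only [Nat.reduceAdd]; omega) (by simp only [Nat.reduceAdd]; omega)).elim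
    rcases (show ω 4 0 = 1 ∨ ω 4 0 = 2 by omega) with h4 | h4
    · rcases (show ω 3 0 = 1 ∨ ω 3 0 = 2 by omega) with h3 | h3
      · exfalso
        rcases (show ω 2 0 = 1 ∨ ω 2 0 = 2 by omega) with h2 | h2
        · exact mono fun i hi => by interval_cases i <;> simp only [Nat.reduceAdd] <;> omega
        · exact ud 1 (by norm_num) (by simp only [Nat.reduceAdd]; omega) (by simp only [Nat.reduceAdd]; omega)
      · rcases (show ω 2 0 = 1 ∨ ω 2 0 = 2 by omega) with h2 | h2
        · exact (ud 2 (by norm_num) (by simp only [Nat.reduceAdd]; omega) (by simp only [Nat.reduceAdd]; omega)).elim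
        · exact Or.inr (Or.inl ⟨h2, h3, h4, h5, h6⟩)
    · rcases (show ω 3 0 = 1 ∨ ω 3 0 = 2 by omega) with h3 | h3
      · exact (ud 3 (by norm_num) (by simp only [Nat.reduceAdd]; omega) (by simp only [Nat.reduceAdd]; omega)).elim
      · rcases (show ω 2 0 = 1 ∨ ω 2 0 = 2 by omega) with h2 | h2
        · exact Or.inr (Or.inr (Or.inr ⟨h2, h3, h4, h5, h6⟩))
        · exact Or.inr (Or.inr (Or.inl ⟨h2, h3, h4, h5, h6⟩))
  · -- `h₆ = 2`
    rcases (show ω 5 0 = 1 ∨ ω 5 0 = 2 by omega) with h5 | h5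
    · -- `h₅ = 1`: `h₄ = 1` (else `2,1,2`), `h₃ = 2` (else mono / `1,2,1`), `h₂ = 2` (else `1,2,1`)
      have h4 : ω 4 0 = 1 := by
        rcases (show ω 4 0 = 1 ∨ ω 4 0 = 2 by omega) with h | h4
        · exact h
        · exact (du 4 (by norm_num) (by simp only [Nat.reduceAdd]; omega) (by simp only [Nat.reduceAdd]; omega)).elim
      have h3 : ω 3 0 = 2 := by
        rcases (show ω 3 0 = 1 ∨ ω 3 0 = 2 by omega) with h3 | h
        · exfalso
          rcases (show ω 2 0 = 1 ∨ ω 2 0 = 2 by omega) with h2 | h2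
          · exact mono fun i hi => by interval_cases i <;> simp only [Nat.reduceAdd] <;> omega
          · exact ud 1 (by norm_num) (by simp only [Nat.reduceAdd]; omega) (by simp only [Nat.reduceAdd]; omega)
        · exact h
      have h2 : ω 2 0 = 2 := by
        rcases (show ω 2 0 = 1 ∨ ω 2 0 = 2 by omega) with h2 | h
        · exact (ud 2 (by norm_num) (by simp only [Nat.reduceAdd]; omega) (by simp only [Nat.reduceAdd]; omega)).elim
        · exact h
      exact Or.inl ⟨h2, h3, h4, h5, h6⟩
    · -- `h₅ = h₆ = h₇ = 2`: every choice of `h₂, h₃, h₄` is monotone or has `1,2,1` / `2,1,2`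
      exfalso
      rcases (show ω 4 0 = 1 ∨ ω 4 0 = 2 by omega) with h4 | h4
      · rcases (show ω 3 0 = 1 ∨ ω 3 0 = 2 by omega) with h3 | h3
        · rcases (show ω 2 0 = 1 ∨ ω 2 0 = 2 by omega) with h2 | h2
          · exact mono fun i hi => by interval_cases i <;> simp only [Nat.reduceAdd] <;> omega
          · exact ud 1 (by norm_num) (by simp only [Nat.reduceAdd]; omega) (by simp only [Nat.reduceAdd]; omega)
        · exact du 3 (by norm_num) (by simp only [Nat.reduceAdd]; omega) (by simp only [Nat.reduceAdd]; omega)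
      · rcases (show ω 3 0 = 1 ∨ ω 3 0 = 2 by omega) with h3 | h3
        · rcases (show ω 2 0 = 1 ∨ ω 2 0 = 2 by omega) with h2 | h2
          · exact mono fun i hi => by interval_cases i <;> simp only [Nat.reduceAdd] <;> omega
          · exact ud 1 (by norm_num) (by simp only [Nat.reduceAdd]; omega) (by simp only [Nat.reduceAdd]; omega)
        · exact mono fun i hi => by interval_cases i <;> simp only [Nat.reduceAdd] <;> omega

/-- ★ **Every cost-five irreducible bridge of length seven is `hook7 κ (v,w,x)` for some profile `κ` and `(v,w,x) ∈ fourStepIndex`.**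
[cite: MadrasSlade1993, Definition 1.2.4] -/
theorem eq_hook7_of_mem (d : ℕ) {ω : ℕ → Site (d + 1)}
    (hω : ω ∈ (irreducibleBridges (d + 1) 7).filter fun ω => costZd d 7 ω = 5) :
    ∃ κ : Fin 4, ∃ s ∈ fourStepIndex d, ω = hook7 d κ s := by
  obtain ⟨h1, h7, hprof⟩ := heights_of_mem_seven d hω
  obtain ⟨hirr, -⟩ := Finset.mem_filter.1 hω
  obtain ⟨hbr, -⟩ := mem_irreducibleBridges.1 hirr
  obtain ⟨hωs, -⟩ := mem_bridges.1 hbr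
  obtain ⟨h0, hend, hadj, hinj⟩ := mem_saws.1 hωs
  have hω1 : ω 1 = Pi.single 0 1 := apply_one_eq_e0_of_mem_bridges d (by norm_num) hbr
  have hmem : ∀ i : ℕ, i ≤ 7 → i ∈ {j : ℕ | j ≤ 7} := fun i hi => hi
  have two := e0_add_e0 d
  -- abbreviations for the step lemmas
  have up : ∀ i, i < 7 → ω (i + 1) 0 = ω i 0 + 1 → ω (i + 1) = ω i + Pi.single 0 1 :=
    fun i hi h => eq_add_e0_of_adj d (hadj i hi) h
  have dn : ∀ i, i < 7 → ω (i + 1) 0 = ω i 0 - 1 → ω (i + 1) = ω i - Pi.single 0 1 :=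
    fun i hi h => eq_sub_e0_of_adj d (hadj i hi) h
  have tr : ∀ i, i < 7 → ω (i + 1) 0 = ω i 0 → ∃ a, ω (i + 1) = ω i + twoStepV d a :=
    fun i hi h => exists_twoStepV_of_adj d (hadj i hi) h
  -- conclude from the seven values and the frozen tail
  have finish : ∀ (κ : Fin 4) (s : (Fin d × Bool) × (Fin d × Bool) × (Fin d × Bool)), s ∈ fourStepIndex d →
      (∀ i, i ≤ 7 → ω i = hook7 d κ s i) → ∃ κ : Fin 4, ∃ s ∈ fourStepIndex d, ω = hook7 d κ s := by
    intro κ s hs hval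
    refine ⟨κ, s, hs, funext fun i => ?_⟩
    rcases Nat.lt_or_ge i 7 with hi | hi
    · exact hval i hi.le
    · rw [hend i hi, hook7_of_seven_le d κ s hi, hval 7 le_rfl]
  rcases hprof with ⟨h2, h3, h4, h5, h6⟩ | ⟨h2, h3, h4, h5, h6⟩ | ⟨h2, h3, h4, h5, h6⟩ | ⟨h2, h3, h4, h5, h6⟩
  · -- profile 0: U U T D T U T
    have e2 := up 1 (by norm_num) (by rw [h2, h1]; norm_num)
    obtain ⟨v, e3⟩ := tr 2 (by norm_num) (by rw [h3, h2])
    have e4 := dn 3 (by norm_num) (by rw [h4, h3]; norm_num)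
    obtain ⟨w, e5⟩ := tr 4 (by norm_num) (by rw [h5, h4])
    have e6 := up 5 (by norm_num) (by rw [h6, h5]; norm_num)
    obtain ⟨x, e7⟩ := tr 6 (by norm_num) (by rw [h7, h6])
    have hω2 : ω 2 = Pi.single 0 2 := by rw [e2, hω1, two]
    have hω3 : ω 3 = Pi.single 0 2 + twoStepV d v := by rw [e3, hω2]
    have hω4 : ω 4 = Pi.single 0 1 + twoStepV d v := by
      rw [e4, hω3, ← two]; abel
    have hω5 : ω 5 = Pi.single 0 1 + (twoStepV d v + twoStepV d w) := by rw [e5, hω4]; abel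
    have hω6 : ω 6 = Pi.single 0 2 + (twoStepV d v + twoStepV d w) := by rw [e6, hω5, ← two]; abel
    have hω7 : ω 7 = Pi.single 0 2 + (twoStepV d v + twoStepV d w + twoStepV d x) := by rw [e7, hω6]; abel
    have hvw : w ≠ revIdx v := by
      intro hwv
      have h62 : ω 6 = ω 2 := by rw [hω6, hω2, hwv, revIdx, twoStepV_not, add_neg_cancel, add_zero]
      have := hinj (hmem 6 (by norm_num)) (hmem 2 (by norm_num)) h62
      omega
    have hwx : x ≠ revIdx w := by
      intro hxw
      have h73 : ω 7 = ω 3 := by rw [hω7, hω3, hxw, revIdx, twoStepV_not, add_assoc, add_neg_cancel, add_zero]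
      have := hinj (hmem 7 le_rfl) (hmem 3 (by norm_num)) h73
      omega
    refine finish 0 (v, w, x) (Finset.mem_filter.2 ⟨Finset.mem_univ _, hvw, hwx⟩) fun i hi => ?_
    interval_cases i <;> simp [hook7, hook7H, hook7T, psum3, h0, hω1, hω2, hω3, hω4, hω5, hω6, hω7]
  · -- profile 1: U U T D T T U
    have e2 := up 1 (by norm_num) (by rw [h2, h1]; norm_num)
    obtain ⟨v, e3⟩ := tr 2 (by norm_num) (by rw [h3, h2])
    have e4 := dn 3 (by norm_num) (by rw [h4, h3]; norm_num)
    obtain ⟨w, e5⟩ := tr 4 (by norm_num) (by rw [h5, h4])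
    obtain ⟨x, e6⟩ := tr 5 (by norm_num) (by rw [h6, h5])
    have e7 := up 6 (by norm_num) (by rw [h7, h6]; norm_num)
    have hω2 : ω 2 = Pi.single 0 2 := by rw [e2, hω1, two]
    have hω3 : ω 3 = Pi.single 0 2 + twoStepV d v := by rw [e3, hω2]
    have hω4 : ω 4 = Pi.single 0 1 + twoStepV d v := by rw [e4, hω3, ← two]; abel
    have hω5 : ω 5 = Pi.single 0 1 + (twoStepV d v + twoStepV d w) := by rw [e5, hω4]; abel
    have hω6 : ω 6 = Pi.single 0 1 + (twoStepV d v + twoStepV d w + twoStepV d x) := by rw [e6, hω5]; abel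
    have hω7 : ω 7 = Pi.single 0 2 + (twoStepV d v + twoStepV d w + twoStepV d x) := by rw [e7, hω6, ← two]; abel
    have hvw : w ≠ revIdx v := by
      intro hwv
      have h51 : ω 5 = ω 1 := by rw [hω5, hω1, hwv, revIdx, twoStepV_not, add_neg_cancel, add_zero]
      have := hinj (hmem 5 (by norm_num)) (hmem 1 (by norm_num)) h51
      omega
    have hwx : x ≠ revIdx w := by
      intro hxw
      have h64 : ω 6 = ω 4 := by rw [hω6, hω4, hxw, revIdx, twoStepV_not, add_assoc, add_neg_cancel, add_zero]
      have := hinj (hmem 6 (by norm_num)) (hmem 4 (by norm_num)) h64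
      omega
    refine finish 1 (v, w, x) (Finset.mem_filter.2 ⟨Finset.mem_univ _, hvw, hwx⟩) fun i hi => ?_
    interval_cases i <;> simp [hook7, hook7H, hook7T, psum3, h0, hω1, hω2, hω3, hω4, hω5, hω6, hω7]
  · -- profile 2: U U T T D T U
    have e2 := up 1 (by norm_num) (by rw [h2, h1]; norm_num)
    obtain ⟨v, e3⟩ := tr 2 (by norm_num) (by rw [h3, h2])
    obtain ⟨w, e4⟩ := tr 3 (by norm_num) (by rw [h4, h3])
    have e5 := dn 4 (by norm_num) (by rw [h5, h4]; norm_num)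
    obtain ⟨x, e6⟩ := tr 5 (by norm_num) (by rw [h6, h5])
    have e7 := up 6 (by norm_num) (by rw [h7, h6]; norm_num)
    have hω2 : ω 2 = Pi.single 0 2 := by rw [e2, hω1, two]
    have hω3 : ω 3 = Pi.single 0 2 + twoStepV d v := by rw [e3, hω2]
    have hω4 : ω 4 = Pi.single 0 2 + (twoStepV d v + twoStepV d w) := by rw [e4, hω3]; abel
    have hω5 : ω 5 = Pi.single 0 1 + (twoStepV d v + twoStepV d w) := by rw [e5, hω4, ← two]; abel
    have hω6 : ω 6 = Pi.single 0 1 + (twoStepV d v + twoStepV d w + twoStepV d x) := by rw [e6, hω5]; abel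
    have hω7 : ω 7 = Pi.single 0 2 + (twoStepV d v + twoStepV d w + twoStepV d x) := by rw [e7, hω6, ← two]; abel
    have hvw : w ≠ revIdx v := by
      intro hwv
      have h42 : ω 4 = ω 2 := by rw [hω4, hω2, hwv, revIdx, twoStepV_not, add_neg_cancel, add_zero]
      have := hinj (hmem 4 (by norm_num)) (hmem 2 (by norm_num)) h42
      omega
    have hwx : x ≠ revIdx w := by
      intro hxw
      have h73 : ω 7 = ω 3 := by rw [hω7, hω3, hxw, revIdx, twoStepV_not, add_assoc, add_neg_cancel, add_zero]
      have := hinj (hmem 7 le_rfl) (hmem 3 (by norm_num)) h73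
      omega
    refine finish 2 (v, w, x) (Finset.mem_filter.2 ⟨Finset.mem_univ _, hvw, hwx⟩) fun i hi => ?_
    interval_cases i <;> simp [hook7, hook7H, hook7T, psum3, h0, hω1, hω2, hω3, hω4, hω5, hω6, hω7]
  · -- profile 3: U T U T D T U
    obtain ⟨v, e2⟩ := tr 1 (by norm_num) (by rw [h2, h1])
    have e3 := up 2 (by norm_num) (by rw [h3, h2]; norm_num)
    obtain ⟨w, e4⟩ := tr 3 (by norm_num) (by rw [h4, h3])
    have e5 := dn 4 (by norm_num) (by rw [h5, h4]; norm_num)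
    obtain ⟨x, e6⟩ := tr 5 (by norm_num) (by rw [h6, h5])
    have e7 := up 6 (by norm_num) (by rw [h7, h6]; norm_num)
    have hω2 : ω 2 = Pi.single 0 1 + twoStepV d v := by rw [e2, hω1]
    have hω3 : ω 3 = Pi.single 0 2 + twoStepV d v := by rw [e3, hω2, ← two]; abel
    have hω4 : ω 4 = Pi.single 0 2 + (twoStepV d v + twoStepV d w) := by rw [e4, hω3]; abel
    have hω5 : ω 5 = Pi.single 0 1 + (twoStepV d v + twoStepV d w) := by rw [e5, hω4, ← two]; abel
    have hω6 : ω 6 = Pi.single 0 1 + (twoStepV d v + twoStepV d w + twoStepV d x) := by rw [e6, hω5]; abel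
    have hω7 : ω 7 = Pi.single 0 2 + (twoStepV d v + twoStepV d w + twoStepV d x) := by rw [e7, hω6, ← two]; abel
    have hvw : w ≠ revIdx v := by
      intro hwv
      have h51 : ω 5 = ω 1 := by rw [hω5, hω1, hwv, revIdx, twoStepV_not, add_neg_cancel, add_zero]
      have := hinj (hmem 5 (by norm_num)) (hmem 1 (by norm_num)) h51
      omega
    have hwx : x ≠ revIdx w := by
      intro hxw
      have h62 : ω 6 = ω 2 := by rw [hω6, hω2, hxw, revIdx, twoStepV_not, add_assoc, add_neg_cancel, add_zero]
      have := hinj (hmem 6 (by norm_num)) (hmem 2 (by norm_num)) h62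
      omega
    refine finish 3 (v, w, x) (Finset.mem_filter.2 ⟨Finset.mem_univ _, hvw, hwx⟩) fun i hi => ?_
    interval_cases i <;> simp [hook7, hook7H, hook7T, psum3, h0, hω1, hω2, hω3, hω4, hω5, hω6, hω7]

/-! ### Injectivity, disjointness of the four families, and `N_{5,7} = 4 · 2d(2d−1)²` -/

/-- Table fact: each profile has an index with transverse count `1` and one with count `2`. [cite: MadrasSlade1993, Definition 1.2.4] -/
theorem hook7_table_T_hits : ∀ κ : Fin 4, (∃ i, i < 8 ∧ hook7T κ i = 1) ∧ (∃ i, i < 8 ∧ hook7T κ i = 2) := by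
  decide

/-- `hook7 κ` is injective on step data. [cite: MadrasSlade1993, Definition 1.2.4] -/
theorem hook7_injective (d : ℕ) (κ : Fin 4) : Function.Injective (hook7 d κ) := by
  rintro ⟨v, w, x⟩ ⟨v', w', x'⟩ h
  have hP : ∀ i, psum3 d (v, w, x) (hook7T κ i) = psum3 d (v', w', x') (hook7T κ i) := fun i => by
    have := congrFun h i
    simpa [hook7] using this
  obtain ⟨⟨i1, -, hi1⟩, ⟨i2, -, hi2⟩⟩ := hook7_table_T_hits κ
  obtain ⟨-, -, -, -, -, hT7⟩ := hook7_table_ends κ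
  have h1 := hP i1
  rw [hi1] at h1
  simp only [psum3] at h1
  have hv : v = v' := twoStepV_injective d h1
  have h2 := hP i2
  rw [hi2] at h2
  simp only [psum3, hv, add_right_inj] at h2
  have hw : w = w' := twoStepV_injective d h2
  have h3 := hP 7
  rw [hT7] at h3
  simp only [psum3, hv, hw, add_right_inj] at h3
  have hx : x = x' := twoStepV_injective d h3
  rw [hv, hw, hx]

/-- Walks of different profiles are different (their height sequences differ). [cite: MadrasSlade1993, Definition 1.2.4] -/
theorem hook7_profile_eq (d : ℕ) {κ κ' : Fin 4} {s s'} (h : hook7 d κ s = hook7 d κ' s') : κ = κ' := by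
  refine hook7_table_sep κ κ' fun i _ => ?_
  have := congrFun (congrFun h i) 0
  rw [hook7_apply_zero, hook7_apply_zero] at this
  exact_mod_cast this

/-- ★ The cost-five irreducible bridges of length seven are exactly the four hook families over `fourStepIndex`.
[cite: MadrasSlade1993, §4.2, eq. (4.2.20)–(4.2.22) (p. 94, 2013 reprint)] -/
theorem filter_costZd_five_seven_eq (d : ℕ) [DecidableEq (ℕ → Site (d + 1))] :
    ((irreducibleBridges (d + 1) 7).filter fun ω => costZd d 7 ω = 5) =
      (Finset.univ : Finset (Fin 4)).biUnion fun κ => (fourStepIndex d).image (hook7 d κ) := by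
  ext ω
  constructor
  · intro h
    obtain ⟨κ, s, hs, rfl⟩ := eq_hook7_of_mem d h
    exact Finset.mem_biUnion.2 ⟨κ, Finset.mem_univ _, Finset.mem_image_of_mem _ hs⟩
  · intro h
    obtain ⟨κ, -, hκ⟩ := Finset.mem_biUnion.1 h
    obtain ⟨s, hs, rfl⟩ := Finset.mem_image.1 hκ
    exact hook7_mem_filter d κ hs

/-- ★ **`N_{5,7} = 4 · 2d(2d−1)²`** on `ℤ^{d+1}` (four profiles, each a `2d(2d−1)²`-family). [cite: MadrasSlade1993, §4.2, eq. (4.2.20)–(4.2.22) (p. 94, 2013 reprint)] -/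
theorem costCoeffZd_five_seven (d : ℕ) : costCoeffZd d 5 7 = 4 * (2 * d * (2 * d - 1) ^ 2) := by
  classical
  rw [costCoeffZd, filter_costZd_five_seven_eq, Finset.card_biUnion]
  · have : ∀ κ ∈ (Finset.univ : Finset (Fin 4)), ((fourStepIndex d).image (hook7 d κ)).card = 2 * d * (2 * d - 1) ^ 2 := by
      intro κ _
      rw [Finset.card_image_of_injective _ (hook7_injective d κ), card_fourStepIndex]
    rw [Finset.sum_congr rfl this, Finset.sum_const, Finset.card_univ, Fintype.card_fin, smul_eq_mul]
  · intro κ _ κ' _ hne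
    simp only [Function.onFun]
    rw [Finset.disjoint_left]
    intro ω hω hω'
    obtain ⟨s, -, rfl⟩ := Finset.mem_image.1 hω
    obtain ⟨s', -, h'⟩ := Finset.mem_image.1 hω'
    exact hne (hook7_profile_eq d h'.symm)

/-- ★ **`N_{5,n}`** on `ℤ^{d+1}`: `2d(2d−1)⁴ − 2d(2d−2)(4d−3)` at `n = 6`, `4·2d(2d−1)²` at `n = 7`, zero otherwise.
[cite: MadrasSlade1993, §4.2, eq. (4.2.20)–(4.2.22) (p. 94, 2013 reprint)] -/
theorem costCoeffZd_five (d n : ℕ) : costCoeffZd d 5 n =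
    if n = 6 then 2 * d * (2 * d - 1) ^ 4 - 2 * d * (2 * d - 2) * (4 * d - 3) else if n = 7 then 4 * (2 * d * (2 * d - 1) ^ 2) else 0 := by
  by_cases h6 : n = 6
  · subst h6; rw [if_pos rfl, costCoeffZd_five_six]
  rw [if_neg h6]
  by_cases h7 : n = 7
  · subst h7; rw [if_pos rfl, costCoeffZd_five_seven]
  rw [if_neg h7]
  rcases Nat.lt_or_ge n 6 with h | h
  · exact costCoeffZd_eq_zero_of_le (by omega)
  · exact costCoeffZd_eq_zero_of_three_span (by omega) (by omega)

/-! ### The moments of the cost data up to cost five and `c^{(d)}_5` -/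

/-- `pQ₁ = 0`. [cite: JansevanRensburgWhittington2013, §3.2 Theorem 8 (arXiv v4 p. 11)] -/
theorem pQ_one (d : ℕ) : CostSeries.pQ (costCoeffZd d) 1 = 0 := by
  rw [CostSeries.pQ, show 2 * 1 + 2 = 4 from rfl]
  simp only [Finset.sum_range_succ, Finset.sum_range_zero, costCoeffZd_one_two,
    costCoeffZd_one_of_ne_two d (show (0:ℕ) ≠ 2 by norm_num), costCoeffZd_one_of_ne_two d (show (1:ℕ) ≠ 2 by norm_num),
    costCoeffZd_one_of_ne_two d (show (3:ℕ) ≠ 2 by norm_num), Nat.choose]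
  push_cast; ring

/-- `pT₂ = 2d(2d−1)`. [cite: JansevanRensburgWhittington2013, §3.2 Theorem 8 (arXiv v4 p. 11)] -/
theorem pT_two (d : ℕ) : CostSeries.pT (costCoeffZd d) 2 = 2 * d * (2 * d - 1) := by
  rw [CostSeries.pT, show 2 * 2 + 2 = 6 from rfl]
  simp only [Finset.sum_range_succ, Finset.sum_range_zero, costCoeffZd_two, Nat.choose]
  rcases Nat.eq_zero_or_pos d with rfl | hd
  · simp
  · obtain ⟨e, rfl⟩ : ∃ e, d = e + 1 := ⟨d - 1, by omega⟩
    simp only [show 2 * (e + 1) - 1 = 2 * e + 1 by omega]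
    push_cast; ring

/-- `pH₃ = 6 · 2d(2d−1)²`. [cite: JansevanRensburgWhittington2013, §3.2 Theorem 8 (arXiv v4 p. 11)] -/
theorem pH_three (d : ℕ) : CostSeries.pH (costCoeffZd d) 3 = 6 * (2 * d * (2 * d - 1) ^ 2) := by
  rw [CostSeries.pH, show 2 * 3 + 2 = 8 from rfl]
  simp only [Finset.sum_range_succ, Finset.sum_range_zero, costCoeffZd_three, Nat.choose]
  rcases Nat.eq_zero_or_pos d with rfl | hd
  · simp
  · obtain ⟨e, rfl⟩ : ∃ e, d = e + 1 := ⟨d - 1, by omega⟩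
    simp only [show 2 * (e + 1) - 1 = 2 * e + 1 by omega]
    push_cast; ring

/-- `pD₄ = 5 N_{4,5} + 6 N_{4,6} = 80d⁴ − 120d³ + 64d² − 2d`. [cite: JansevanRensburgWhittington2013, §3.2 Theorem 8 (arXiv v4 p. 11)] -/
theorem pD_four (d : ℕ) : CostSeries.pD (costCoeffZd d) 4 = 80 * d ^ 4 - 120 * d ^ 3 + 64 * d ^ 2 - 2 * d := by
  have h45 := costCoeffZd_four_five_add d
  rw [CostSeries.pD, show 2 * 4 + 2 = 10 from rfl]
  simp only [Finset.sum_range_succ, Finset.sum_range_zero, costCoeffZd_four_six, costCoeffZd_four_seven,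
    costCoeffZd_eq_zero_of_le (show 0 ≤ 4 by norm_num), costCoeffZd_eq_zero_of_le (show 1 ≤ 4 by norm_num),
    costCoeffZd_eq_zero_of_le (show 2 ≤ 4 by norm_num), costCoeffZd_eq_zero_of_le (show 3 ≤ 4 by norm_num),
    costCoeffZd_eq_zero_of_le (show 4 ≤ 4 from le_rfl),
    costCoeffZd_eq_zero_of_lt (show 3 * 4 + 2 < 2 * 8 by norm_num), costCoeffZd_eq_zero_of_lt (show 3 * 4 + 2 < 2 * 9 by norm_num)]
  rcases Nat.eq_zero_or_pos d with rfl | hd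
  · simp at h45 ⊢
    have : costCoeffZd 0 4 5 = 0 := by simpa using h45
    simp [this]
  · obtain ⟨e, rfl⟩ : ∃ e, d = e + 1 := ⟨d - 1, by omega⟩
    simp only [show 2 * (e + 1) - 1 = 2 * e + 1 by omega, show 2 * (e + 1) - 2 = 2 * e by omega] at h45 ⊢
    have h45' : (costCoeffZd (e + 1) 4 5 : ℤ) = 2 * (e + 1) * (2 * e + 1) ^ 3 - 2 * (e + 1) * (2 * e) := by
      have := congrArg (fun m : ℕ => (m : ℤ)) h45
      push_cast at this
      linarith
    push_cast
    rw [h45']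
    ring

/-- ★ `pS₅ = N_{5,6} + N_{5,7} = 32d⁵ − 64d⁴ + 64d³ − 20d² − 2d`. [cite: JansevanRensburgWhittington2013, §3.2 Theorem 8 (arXiv v4 p. 11)] -/
theorem pS_five (d : ℕ) : CostSeries.pS (costCoeffZd d) 5 = 32 * d ^ 5 - 64 * d ^ 4 + 64 * d ^ 3 - 20 * d ^ 2 - 2 * d := by
  have h56 := costCoeffZd_five_six_add d
  rw [CostSeries.pS, show 2 * 5 + 2 = 12 from rfl]
  simp only [Finset.sum_range_succ, Finset.sum_range_zero, costCoeffZd_five_seven,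
    costCoeffZd_eq_zero_of_le (show 0 ≤ 5 by norm_num), costCoeffZd_eq_zero_of_le (show 1 ≤ 5 by norm_num),
    costCoeffZd_eq_zero_of_le (show 2 ≤ 5 by norm_num), costCoeffZd_eq_zero_of_le (show 3 ≤ 5 by norm_num),
    costCoeffZd_eq_zero_of_le (show 4 ≤ 5 by norm_num), costCoeffZd_eq_zero_of_le (show 5 ≤ 5 from le_rfl),
    costCoeffZd_eq_zero_of_three_span (show 5 + 2 ≤ 8 by norm_num) (show 3 * 5 < 2 * 8 by norm_num),
    costCoeffZd_eq_zero_of_three_span (show 5 + 2 ≤ 9 by norm_num) (show 3 * 5 < 2 * 9 by norm_num),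
    costCoeffZd_eq_zero_of_three_span (show 5 + 2 ≤ 10 by norm_num) (show 3 * 5 < 2 * 10 by norm_num),
    costCoeffZd_eq_zero_of_three_span (show 5 + 2 ≤ 11 by norm_num) (show 3 * 5 < 2 * 11 by norm_num)]
  rcases Nat.eq_zero_or_pos d with rfl | hd
  · simp at h56 ⊢
    have : costCoeffZd 0 5 6 = 0 := by simpa using h56
    simp [this]
  · obtain ⟨e, rfl⟩ : ∃ e, d = e + 1 := ⟨d - 1, by omega⟩
    simp only [show 2 * (e + 1) - 1 = 2 * e + 1 by omega, show 2 * (e + 1) - 2 = 2 * e by omega,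
      show 4 * (e + 1) - 3 = 4 * e + 1 by omega] at h56 ⊢
    have h56' : (costCoeffZd (e + 1) 5 6 : ℤ) = 2 * (e + 1) * (2 * e + 1) ^ 4 - 2 * (e + 1) * (2 * e) * (4 * e + 1) := by
      have := congrArg (fun m : ℕ => (m : ℤ)) h56
      push_cast at this
      linarith
    push_cast
    rw [h56']
    ring

/-- `a₅ = −(32d⁵ + 160d⁴ + 168d³ + 12d² − 2d)` on `ℤ^{d+1}`. [cite: JansevanRensburgWhittington2013, §3.2 Theorem 8 (arXiv v4 p. 11)] -/
theorem aZd_five (d : ℕ) : CostSeries.a (costCoeffZd d) 5 = -(32 * d ^ 5 + 160 * d ^ 4 + 168 * d ^ 3 + 12 * d ^ 2 - 2 * d) := by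
  rw [CostSeries.a_five, aZd_one, aZd_two, aZd_three, aZd_four, pD_one, pH_one, pT_one, pQ_one, pD_two, pH_two, pT_two, pD_three,
    pH_three, pD_four, pS_five]
  ring

/-- ★★ **THE FIFTH COEFFICIENT: `c^{(d)}_5 = 2d(8d³ + 28d² + 2d − 1)`** on `ℤ^{d+1}`, every dimension.
[cite: JansevanRensburgWhittington2013, §3.2 Theorem 8 (arXiv v4 p. 11)] -/
theorem largeForceCoeffZd_at_five (d : ℕ) : largeForceCoeffZd d 5 = 2 * d * (8 * d ^ 3 + 28 * d ^ 2 + 2 * d - 1) := by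
  have e1 : CostSeries.e (costCoeffZd d) 1 = 2 * d := largeForceCoeffZd_at_one d
  have e2 : CostSeries.e (costCoeffZd d) 2 = -(2 * (d : ℤ)) := largeForceCoeffZd_at_two d
  have e3 : CostSeries.e (costCoeffZd d) 3 = 2 * d * (2 * d + 1) := largeForceCoeffZd_at_three d
  have e4 : CostSeries.e (costCoeffZd d) 4 = -(4 * (d : ℤ) ^ 2 * (2 * d + 3)) := largeForceCoeffZd_at_four d
  show CostSeries.e (costCoeffZd d) 5 = _
  rw [CostSeries.e_five_eq, aZd_one, aZd_two, aZd_three, aZd_four, aZd_five, e1, e2, e3, e4]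
  ring

/-- `c_5 = 74` on `ℤ²` (the certified value of `SAWPulledLargeForceFifthOrderLower`, here without certificates).
[cite: JansevanRensburgWhittington2013, §3.2 Theorem 8 (arXiv v4 p. 11)] -/
theorem largeForceCoeff_five_eq : largeForceCoeff 5 = 74 := by
  rw [← largeForceCoeffZd_one 5, largeForceCoeffZd_at_five]; norm_num

/-- ★★ **`e^{λ_B(y)} = y + 2d − 2d/y + 2d(2d+1)/y² − 4d²(2d+3)/y³ + 2d(8d³+28d²+2d−1)/y⁴ + O(1/y⁵)` on `ℤ^{d+1}`, every dimension.**
[cite: JansevanRensburgWhittington2013, §3.2 Theorem 8 (arXiv v4 p. 11)] -/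
theorem exp_pulledBridgeFreeEnergy_fifth_order_zd (d : ℕ) :
    ∃ C y₁ : ℝ, 0 < y₁ ∧ ∀ y ≥ y₁,
      |Real.exp (pulledBridgeFreeEnergy (d + 1) y) -
        (y + 2 * d - 2 * d / y + 2 * d * (2 * d + 1) / y ^ 2 - 4 * d ^ 2 * (2 * d + 3) / y ^ 3 +
          2 * d * (8 * d ^ 3 + 28 * d ^ 2 + 2 * d - 1) / y ^ 4)| ≤ C / y ^ 5 := by
  obtain ⟨C, y₁, hy₁, h⟩ := exp_pulledBridgeFreeEnergy_expansion_zd d 5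
  refine ⟨C, y₁, hy₁, fun y hy => ?_⟩
  have hy0 : 0 < y := lt_of_lt_of_le hy₁ hy
  have h1 := h y hy
  have hs : ∑ k ∈ Finset.range (5 + 1), y * ((largeForceCoeffZd d k : ℝ) * y⁻¹ ^ k) =
      y + 2 * d - 2 * d / y + 2 * d * (2 * d + 1) / y ^ 2 - 4 * d ^ 2 * (2 * d + 3) / y ^ 3 +
        2 * d * (8 * d ^ 3 + 28 * d ^ 2 + 2 * d - 1) / y ^ 4 := by
    rw [Finset.sum_range_succ, Finset.sum_range_succ, Finset.sum_range_succ, Finset.sum_range_succ, Finset.sum_range_succ,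
      Finset.sum_range_one, largeForceCoeffZd_zero, largeForceCoeffZd_at_one, largeForceCoeffZd_at_two, largeForceCoeffZd_at_three,
      largeForceCoeffZd_at_four, largeForceCoeffZd_at_five]
    push_cast
    field_simp
    ring
  rwa [hs] at h1

end Literature.Probability.RandomPlanarGeometry.SAW.Zd

end
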